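import Mathlib
import HarnessLib

/-!
# Marginalisation of a finite product of identical probability measures along an injection

For a probability measure `μ` on `α`, finite index types `ι`, `κ` and an injection
`e : κ ↪ ι`, the coordinate-restriction map `W ↦ (i ↦ W (e i)) : (ι → α) → (κ → α)` pushes the
product measure `⨂_ι μ` forward to `⨂_κ μ` (`measurePreserving_comp_embedding`); consequently
`∫ g (W ∘ e) d(⨂_ι μ) = ∫ g d(⨂_κ μ)` (`integral_comp_embedding_pi`): the coordinates a function
does not read integrate out.  (Mathlib has the projective-family form
`MeasureTheory.isProjectiveMeasureFamily_pi` for restrictions between finsets of a possibly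
infinite index type; this is the plain finite statement along an arbitrary injection.)
-/

namespace Literature.MeasureTheory.Integral

open _root_.MeasureTheory
open scoped BigOperators

variable {ι κ α : Type*} [Fintype ι] [Fintype κ] [MeasurableSpace α]

/-- Restriction of coordinates along an injection is measure preserving between the product
probability measures. [folklore] -/
theorem measurePreserving_comp_embedding (μ : Measure α) [IsProbabilityMeasure μ] (e : κ ↪ ι) :
    MeasurePreserving (fun W : ι → α => fun i : κ => W (e i))
      (Measure.pi fun _ : ι => μ) (Measure.pi fun _ : κ => μ) := by
  classical
  refine ⟨measurable_pi_lambda _ fun i => measurable_pi_apply (e i), ?_⟩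
  symm
  refine Measure.pi_eq fun s hs => ?_
  rw [Measure.map_apply (measurable_pi_lambda _ fun i => measurable_pi_apply (e i))
    (MeasurableSet.univ_pi hs)]
  -- the preimage of a box is a box with `univ` in the coordinates outside the range of `e`
  set t : ι → Set α := Function.extend e s fun _ => Set.univ with ht
  have hte : ∀ i : κ, t (e i) = s i := fun i => by
    rw [ht, e.injective.extend_apply]
  have htc : ∀ j : ι, (¬ ∃ i, e i = j) → t j = Set.univ := fun j hj => by
    rw [ht, Function.extend_apply' _ _ _ hj]
  have hpre : (fun W : ι → α => fun i : κ => W (e i)) ⁻¹' Set.univ.pi s = Set.univ.pi t := by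
    ext W
    simp only [Set.mem_preimage, Set.mem_univ_pi]
    constructor
    · intro h j
      by_cases hj : ∃ i, e i = j
      · obtain ⟨i, rfl⟩ := hj
        rw [hte]; exact h i
      · rw [htc j hj]; exact Set.mem_univ _
    · intro h i
      have := h (e i)
      rwa [hte] at this
  rw [hpre, Measure.pi_pi]
  -- the product over `ι` collapses to the product over the range of `e`
  have hsplit : ∏ j : ι, μ (t j) = ∏ j ∈ Finset.univ.map e, μ (t j) := by
    refine (Finset.prod_subset (Finset.subset_univ _) fun j _ hj => ?_).symm
    have hj' : ¬ ∃ i, e i = j := by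
      rintro ⟨i, rfl⟩
      exact hj (Finset.mem_map_of_mem e (Finset.mem_univ i))
    rw [htc j hj', measure_univ]
  rw [hsplit, Finset.prod_map]
  exact Finset.prod_congr rfl fun i _ => by rw [hte]

/-- **Marginalisation**: integrating a function of the `e`-coordinates against the full product
is the same as integrating it against the product over `κ`. [folklore] -/
theorem integral_comp_embedding_pi (μ : Measure α) [IsProbabilityMeasure μ] (e : κ ↪ ι)
    {E : Type*} [NormedAddCommGroup E] [NormedSpace ℝ E] (g : (κ → α) → E)
    (hg : AEStronglyMeasurable g (Measure.pi fun _ : κ => μ)) :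
    ∫ W, g (fun i => W (e i)) ∂(Measure.pi fun _ : ι => μ) =
      ∫ w, g w ∂(Measure.pi fun _ : κ => μ) := by
  have h := measurePreserving_comp_embedding μ e
  rw [← h.map_eq, integral_map h.measurable.aemeasurable]
  rwa [h.map_eq]

end Literature.MeasureTheory.Integral
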